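import Literature.InformationTheory.Coding.SudanListRecovery
import HarnessLib

/-!
# Roth–Ruckenstein root finding, loop form (breadth-first over the recursion tree)

Topic `Literature/InformationTheory/Coding`; companion of `SudanListRecovery.lean`. The coefficient
paths `SudanRR.pathsL elems t Q` of Roth–Ruckenstein's procedure `Reconstruct` (IEEE Trans. Inform.
Theory 46 (2000), §V, Fig. 2) are defined there by structural recursion on the depth `t` (depth
first). A polynomial-time realisation on codes (`Literature/Computability/Complexity/CodeFP.lean`:
polynomially bounded LOOPS) wants the same tree traversed breadth first, level by level, each level
a `flatMap` of the previous one, the frontier truncated to a cap that valid inputs never reach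
(the width bound `SudanRR.length_pathsL_le`, Prop. 6.4 of the paper). This file provides that loop
form over an arbitrary field and proves it lists the same paths:

* `SudanRR.nodesL elems t Q` — the depth-`t` nodes `(path, node polynomial)` of the recursion tree
  (depth first, as `pathsL`); `nodesL_map_fst : (nodesL …).map fst = pathsL …`;
* `SudanRR.rrExpand` (the children of a node), `nodesL_succ : nodesL (t+1) Q = (nodesL t Q).flatMap rrExpand`;
* `SudanRR.rrLevels elems cap t Q` — `t` rounds of "expand every node, keep the first `cap`";
  **`rrLevels_eq_nodesL`**: for duplicate-free `elems` and `max 1 (deg_Y Q) ≤ cap` the cap is never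
  active and `rrLevels elems cap t Q = nodesL elems t Q`; hence **`rrLevels_complete`** (every
  `Y`-root of degree `≤ D` of `Q ≠ 0` has its coefficient list among the level-`(D+1)` paths) and
  `length_rrLevels_le` (at most `max 1 cap` nodes, on every input).

Everything is proved; no named fact.

## References

* R. M. Roth, G. Ruckenstein, *Efficient decoding of Reed–Solomon codes beyond half the minimum
  distance*, IEEE Trans. Inform. Theory 46 (2000) 246–257, §V (Fig. 2, Prop. 5.2), §VI (Prop. 6.4)
  [RothRuckenstein2000].
* S. Arora, B. Barak, *Computational Complexity: A Modern Approach*, CUP 2009, §1.3 (loops with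
  polynomially bounded state) [AroraBarakCC2009].
-/

noncomputable section

namespace Literature.InformationTheory.Coding

open Polynomial
open scoped Polynomial.Bivariate

namespace SudanRR

variable {K : Type*} [Field K]

open Classical in
/-- The roots of `Q₀(0, Y)` (`Q₀ = stripX Q`) searched in the enumeration `elems` (classical
decidability, as in `pathsL`). [cite: RothRuckenstein2000, §V, Fig. 2] -/
def rootsL (elems : List K) (Q : K[X][Y]) : List K :=
  elems.filter fun γ => decide ((atZero (stripX Q)).eval γ = 0)

open Classical in
/-- **The depth-`t` nodes of Roth–Ruckenstein's recursion tree**, each with its path (depth first,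
children in the order of `elems`). [cite: RothRuckenstein2000, §V, Fig. 2] -/
def nodesL (elems : List K) : ℕ → K[X][Y] → List (List K × K[X][Y])
  | 0, Q => [([], Q)]
  | t + 1, Q =>
    if Q = 0 then []
    else (rootsL elems Q).flatMap fun γ => (nodesL elems t (childQ Q γ)).map fun nd => (γ :: nd.1, nd.2)

/-- `nodesL` at depth `0`. [folklore] -/
@[simp] theorem nodesL_zero (elems : List K) (Q : K[X][Y]) : nodesL elems 0 Q = [([], Q)] := rfl

open Classical in
/-- `nodesL` at depth `t + 1`. [folklore] -/
theorem nodesL_succ' (elems : List K) (t : ℕ) (Q : K[X][Y]) :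
    nodesL elems (t + 1) Q = if Q = 0 then []
      else (rootsL elems Q).flatMap fun γ => (nodesL elems t (childQ Q γ)).map fun nd => (γ :: nd.1, nd.2) := rfl

/-- **The paths of the nodes are `pathsL`.** [folklore] -/
theorem nodesL_map_fst (elems : List K) : ∀ (t : ℕ) (Q : K[X][Y]), (nodesL elems t Q).map Prod.fst = pathsL elems t Q
  | 0, Q => rfl
  | t + 1, Q => by
    rw [nodesL_succ']
    by_cases hQ : Q = 0
    · subst hQ; simp
    · have key : ∀ γ, ((nodesL elems t (childQ Q γ)).map fun nd => (γ :: nd.1, nd.2)).map Prod.fst =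
          (pathsL elems t (childQ Q γ)).map (List.cons γ) := fun γ => by
        rw [List.map_map, ← nodesL_map_fst elems t (childQ Q γ), List.map_map]; rfl
      rw [if_neg hQ, pathsL_succ_of_ne elems t hQ, List.map_flatMap]
      simp only [key]
      rfl

/-- The number of depth-`t` nodes is the number of depth-`t` paths. [folklore] -/
theorem length_nodesL (elems : List K) (t : ℕ) (Q : K[X][Y]) : (nodesL elems t Q).length = (pathsL elems t Q).length := by
  rw [← nodesL_map_fst, List.length_map]

/-- `flatMap` of singletons is `map`. [folklore] -/
theorem flatMap_singleton_eq_map' {α β : Type*} (f : α → β) : ∀ l : List α, l.flatMap (fun x => [f x]) = l.map f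
  | [] => rfl
  | a :: l => by rw [List.flatMap_cons, List.map_cons, flatMap_singleton_eq_map' f l]; rfl

open Classical in
/-- **The children of a node** `(path, Q)`: none for `Q = 0`, else one per root `γ` of `Q₀(0, Y)`,
with path `path ++ [γ]` and polynomial `Q₀(X, XY + γ)`. [cite: RothRuckenstein2000, §V, Fig. 2] -/
def rrExpand (elems : List K) (nd : List K × K[X][Y]) : List (List K × K[X][Y]) :=
  if nd.2 = 0 then [] else (rootsL elems nd.2).map fun γ => (nd.1 ++ [γ], childQ nd.2 γ)

/-- Prefixing the path commutes with expansion. [folklore] -/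
theorem rrExpand_cons (elems : List K) (γ : K) (p : List K) (Q : K[X][Y]) :
    rrExpand elems (γ :: p, Q) = (rrExpand elems (p, Q)).map fun nd => (γ :: nd.1, nd.2) := by
  unfold rrExpand
  split_ifs <;> simp

/-- **The next level is the expansion of the current one.** [folklore] -/
theorem nodesL_succ (elems : List K) : ∀ (t : ℕ) (Q : K[X][Y]),
    nodesL elems (t + 1) Q = (nodesL elems t Q).flatMap (rrExpand elems)
  | 0, Q => by
    rw [nodesL_succ', nodesL_zero, List.flatMap_cons, List.flatMap_nil, List.append_nil, rrExpand]
    split_ifs with hQ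
    · rfl
    · simp only [nodesL_zero, List.map_cons, List.map_nil, List.nil_append]
      rw [flatMap_singleton_eq_map']
  | t + 1, Q => by
    rw [nodesL_succ' elems (t + 1), nodesL_succ' elems t]
    split_ifs with hQ
    · rfl
    · rw [List.flatMap_assoc]
      have key : ∀ γ, ((nodesL elems t (childQ Q γ)).flatMap (rrExpand elems)).map (fun nd => (γ :: nd.1, nd.2)) =
          ((nodesL elems t (childQ Q γ)).map fun nd => (γ :: nd.1, nd.2)).flatMap (rrExpand elems) := fun γ => by
        rw [List.map_flatMap, List.flatMap_map]
        refine congrArg (fun F => (nodesL elems t (childQ Q γ)).flatMap F) (_root_.funext fun nd => ?_)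
        obtain ⟨p, R⟩ := nd
        exact (rrExpand_cons elems γ p R).symm
      simp only [nodesL_succ elems t, key]

/-- **Breadth-first loop form with a frontier cap**: `t` rounds of "expand every node, keep the
first `cap` nodes". [cite: RothRuckenstein2000, §V, Fig. 2; AroraBarakCC2009, §1.3] -/
def rrLevels (elems : List K) (cap t : ℕ) (Q : K[X][Y]) : List (List K × K[X][Y]) :=
  (List.replicate t ()).foldl (fun F _ => (F.flatMap (rrExpand elems)).take cap) [([], Q)]

/-- One more round. [folklore] -/
theorem rrLevels_succ (elems : List K) (cap t : ℕ) (Q : K[X][Y]) :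
    rrLevels elems cap (t + 1) Q = ((rrLevels elems cap t Q).flatMap (rrExpand elems)).take cap := by
  rw [rrLevels, rrLevels, List.replicate_succ', List.foldl_append, List.foldl_cons, List.foldl_nil]

/-- The frontier never exceeds the cap (from round `1` on; round `0` has one node). [folklore] -/
theorem length_rrLevels_le (elems : List K) (cap t : ℕ) (Q : K[X][Y]) : (rrLevels elems cap t Q).length ≤ max 1 cap := by
  cases t with
  | zero => simp [rrLevels]
  | succ t => rw [rrLevels_succ, List.length_take]; omega

/-- **The cap is never active on valid inputs**: for duplicate-free `elems` and
`max 1 (deg_Y Q) ≤ cap`, the loop lists exactly the depth-`t` nodes (Roth–Ruckenstein's width bound).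
[cite: RothRuckenstein2000, §VI, Prop. 6.4] -/
theorem rrLevels_eq_nodesL {elems : List K} (hnd : elems.Nodup) {cap : ℕ} {Q : K[X][Y]} (hcap : max 1 Q.natDegree ≤ cap) :
    ∀ t : ℕ, rrLevels elems cap t Q = nodesL elems t Q
  | 0 => rfl
  | t + 1 => by
    rw [rrLevels_succ, rrLevels_eq_nodesL hnd hcap t, ← nodesL_succ]
    apply List.take_of_length_le
    rw [length_nodesL]
    exact (length_pathsL_le hnd (t + 1) Q).trans hcap

/-- **Completeness of the loop form**: for `Q ≠ 0`, duplicate-free `elems` enumerating the field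
and `max 1 (deg_Y Q) ≤ cap`, every `Y`-root `f` of degree `≤ D` has its coefficient list
`[f₀, …, f_D]` among the paths of level `D + 1`, and `ofCoeffs` reads `f` back from it.
[cite: RothRuckenstein2000, §V, Prop. 5.2; §VI, Prop. 6.4] -/
theorem rrLevels_complete {elems : List K} (hnd : elems.Nodup) (helems : ∀ γ : K, γ ∈ elems) {cap D : ℕ}
    {Q : K[X][Y]} (hQ : Q ≠ 0) (hcap : max 1 Q.natDegree ≤ cap) {f : K[X]} (hf : f.natDegree ≤ D) (hev : Q.eval f = 0) :
    ∃ nd ∈ rrLevels elems cap (D + 1) Q, ofCoeffs nd.1 = f := by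
  obtain ⟨l, hl, hlf⟩ := exists_mem_pathsL_ofCoeffs_eq helems hQ hf hev
  rw [← nodesL_map_fst, ← rrLevels_eq_nodesL hnd hcap, List.mem_map] at hl
  obtain ⟨nd, hnd', rfl⟩ := hl
  exact ⟨nd, hnd', hlf⟩

/-- Every listed path at depth `t` has length `t` and entries from `elems`. [folklore] -/
theorem mem_nodesL : ∀ (elems : List K) (t : ℕ) (Q : K[X][Y]) (nd : List K × K[X][Y]), nd ∈ nodesL elems t Q →
    nd.1.length = t ∧ ∀ γ ∈ nd.1, γ ∈ elems
  | elems, 0, Q, nd, h => by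
    simp only [nodesL_zero, List.mem_singleton] at h
    subst h; simp
  | elems, t + 1, Q, nd, h => by
    rw [nodesL_succ'] at h
    split_ifs at h with hQ
    · simp at h
    · obtain ⟨γ, hγ, hnd⟩ := List.mem_flatMap.1 h
      obtain ⟨nd', hnd', rfl⟩ := List.mem_map.1 hnd
      obtain ⟨h1, h2⟩ := mem_nodesL elems t _ nd' hnd'
      refine ⟨by rw [List.length_cons, h1], fun x hx => ?_⟩
      rcases List.mem_cons.1 hx with rfl | hx
      · exact (List.mem_filter.1 hγ).1
      · exact h2 x hx

end SudanRR

end Literature.InformationTheory.Coding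

end
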